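import Summits.KontsevichZagierPeriods.KontsevichZagierPeriods.Theses.StandardParts

/-!
# Route StandardParts — crux `SpArcClosure`, stub `stub_endpointAeEq`: the `L¹`-endpoint of an
eventually constant arc of representations is attained almost everywhere

Problem `KontsevichZagierPeriods`, route `StandardParts`, crux stmt-KontsevichZagierPeriods-3153
(`SpArcClosure`), registered line `Lines/birth.lean`, stub `stub_endpointAeEq` (measure theory
only, no calculus of moves).

Statement. Let `R : ℝ → KZ.IntegralRep n` be an arc of integral representations which is CONSTANT
on `(0, ε)` — same domain, and same integrand on that domain, for all `s, t ∈ (0, ε)` — and let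
`r₀` be a representation such that the `L¹`-distance of the extended-by-zero integrands
`h t := ∫ |1_{dom R_t} f_t − 1_{dom r₀} f₀|` tends to `0` as `t → 0⁺`. Then for every `t ∈ (0, ε)`
the extended integrand `1_{dom R_t} f_t` equals `1_{dom r₀} f₀` Lebesgue-almost everywhere.

Proof.
1. For `s, t ∈ (0, ε)` the extended integrands of `R s` and `R t` are equal as functions
   (`Set.indicator` only reads the values on the domain), so `h` is constant on `(0, ε)`.
2. `(0, ε) ∈ 𝓝[>] 0` (`Ioo_mem_nhdsGT`), so `h` agrees eventually along `𝓝[>] 0` with the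
   constant `h t`; a constant tending to `0` along the nontrivial filter `𝓝[>] 0` is `0`
   (`tendsto_const_nhds_iff`), so `h t = 0`.
3. Both extended integrands are integrable on `ℝⁿ` (`integrable_indicator_iff` with the measurable
   domain `KZ.IntegralRep.measurableSet_domain_holds` and the field `KZ.IntegralRep.integrableOn`),
   so their difference `g` is integrable, and `∫ |g| = 0` with `|g| ≥ 0` forces `|g| = 0` a.e.
   (`MeasureTheory.integral_eq_zero_iff_of_nonneg`), i.e. `g = 0` a.e.

Sources: folklore measure theory (an integrable function with vanishing `L¹`-norm vanishes a.e.);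
M. Kontsevich, D. Zagier, *Periods* (2001), §1.1 for the notion of integral representation. Not
here: the rigidity of semialgebraic arcs (`stub_arcRigidity`, the lead's stub) and the composition
`SpArcClosure_of` (skeleton `Lines/birth.lean`).
-/

noncomputable section

open MeasureTheory Set Filter
open scoped Topology

namespace Summit.KontsevichZagierPeriods.StandardParts

open Literature.NumberTheory.Transcendental Literature.NumberTheory.Transcendental.KZ

variable {n : ℕ}

/-- **The extended-by-zero integrand of a representation is integrable on `ℝⁿ`.** For
`r = [σ, f]`, the function `1_σ f` is integrable for Lebesgue measure: `σ` is measurable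
(`KZ.IntegralRep.measurableSet_domain_holds`) and `f` is integrable on `σ`
(`KZ.IntegralRep.integrableOn`), so `integrable_indicator_iff` applies.
[Kontsevich–Zagier 2001, §1.1] [folklore] -/
theorem integrable_indicator_integrand (r : IntegralRep n) :
    Integrable (r.domain.indicator r.integrand) volume :=
  (integrable_indicator_iff (IntegralRep.measurableSet_domain_holds r)).mpr r.integrableOn

/-- **An integrable real function with vanishing `L¹`-norm of a difference gives a.e. equality.**
If `f` and `g` are integrable and `∫ |f − g| = 0`, then `f = g` almost everywhere
(`MeasureTheory.integral_eq_zero_iff_of_nonneg` applied to `|f − g| ≥ 0`). [folklore] -/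
theorem ae_eq_of_integral_abs_sub_eq_zero {α : Type*} [MeasurableSpace α] {μ : Measure α}
    {f g : α → ℝ} (hf : Integrable f μ) (hg : Integrable g μ)
    (h : ∫ x, |f x - g x| ∂μ = 0) : f =ᵐ[μ] g := by
  have habs : (fun x => |f x - g x|) =ᵐ[μ] 0 :=
    (integral_eq_zero_iff_of_nonneg (fun x => abs_nonneg _) (hf.sub hg).abs).mp h
  filter_upwards [habs] with x hx
  exact sub_eq_zero.mp (abs_eq_zero.mp hx)

/-- **Stub `stub_endpointAeEq` of crux `SpArcClosure` (stmt-KontsevichZagierPeriods-3153, line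
`Lines/birth.lean`) — the `L¹`-endpoint of an eventually constant arc is attained almost
everywhere.** If `R : ℝ → KZ.IntegralRep n` is constant on `(0, ε)` (same domain, same integrand on
it) and `∫ |1_{dom R_t} f_t − 1_{dom r₀} f₀| → 0` as `t → 0⁺`, then for every `t ∈ (0, ε)` the
extended integrand of `R t` equals that of `r₀` almost everywhere: the `L¹`-distance is constant on
`(0, ε) ∈ 𝓝[>] 0` and tends to `0`, so it is `0` (`tendsto_const_nhds_iff`); both extended
integrands are integrable (`integrable_indicator_integrand`), so the difference vanishes a.e.
(`ae_eq_of_integral_abs_sub_eq_zero`). [folklore] -/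
theorem stub_endpointAeEq :
    ∀ ⦃n : ℕ⦄ (R : ℝ → Literature.NumberTheory.Transcendental.KZ.IntegralRep n)
      (r₀ : Literature.NumberTheory.Transcendental.KZ.IntegralRep n) ⦃ε : ℝ⦄, ε ∈ Set.Ioo (0:ℝ) 1 →
      (∀ s ∈ Set.Ioo (0:ℝ) ε, ∀ t ∈ Set.Ioo (0:ℝ) ε,
        (R s).domain = (R t).domain ∧ Set.EqOn (R s).integrand (R t).integrand (R t).domain) →
      Filter.Tendsto (fun t : ℝ => ∫ x, |(R t).domain.indicator (R t).integrand x
          - r₀.domain.indicator r₀.integrand x|) (𝓝[>] (0:ℝ)) (𝓝 0) →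
      ∀ t ∈ Set.Ioo (0:ℝ) ε,
        (R t).domain.indicator (R t).integrand =ᵐ[MeasureTheory.volume] r₀.domain.indicator r₀.integrand := by
  intro n R r₀ ε hε hR hL t ht
  -- Step 1: on `(0, ε)` the extended integrands are equal as functions.
  have hconst : ∀ s ∈ Set.Ioo (0:ℝ) ε,
      (R s).domain.indicator (R s).integrand = (R t).domain.indicator (R t).integrand := by
    intro s hs
    obtain ⟨hdom, heq⟩ := hR s hs t ht
    funext x
    rw [hdom]
    by_cases hx : x ∈ (R t).domain
    · rw [indicator_of_mem hx, indicator_of_mem hx, heq hx]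
    · rw [indicator_of_notMem hx, indicator_of_notMem hx]
  -- Step 2: the `L¹`-distance at `t` vanishes (eventually constant function tending to `0`).
  have hev : (fun s : ℝ => ∫ x, |(R s).domain.indicator (R s).integrand x
      - r₀.domain.indicator r₀.integrand x|) =ᶠ[𝓝[>] (0:ℝ)]
      fun _ => ∫ x, |(R t).domain.indicator (R t).integrand x
        - r₀.domain.indicator r₀.integrand x| := by
    filter_upwards [Ioo_mem_nhdsGT hε.1] with s hs
    rw [hconst s hs]
  have hzero : ∫ x, |(R t).domain.indicator (R t).integrand x
      - r₀.domain.indicator r₀.integrand x| = 0 :=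
    tendsto_const_nhds_iff.mp (hL.congr' hev)
  -- Step 3: integrability of both extended integrands and a.e. vanishing of the difference.
  exact ae_eq_of_integral_abs_sub_eq_zero (integrable_indicator_integrand (R t))
    (integrable_indicator_integrand r₀) hzero

end Summit.KontsevichZagierPeriods.StandardParts
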